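import Summits.KontsevichZagierPeriods.KontsevichZagierPeriods.Theses.IsogenyCertificates
import Summits.KontsevichZagierPeriods.KontsevichZagierPeriods.Theses.UnfoldedStokes
import Summits.KontsevichZagierPeriods.KontsevichZagierPeriods.Theorems.GrothendieckLemniscaticSectorKernel
import Summits.KontsevichZagierPeriods.KontsevichZagierPeriods.Theorems.XMapKernel.Negative.Core
import Literature.NumberTheory.Transcendental.KontsevichZagierGammaProofs

/-!
# Line `singular-modulus-two` — G4 ladder-down RUNG on crux `XMapKernelOfCells`
(item stmt-KontsevichZagierPeriods-18976, route route-KontsevichZagierPeriods-IsogenyCertificates;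
planner-fwd-ladder-KontsevichZagierPeriods-53-0, 2026-08-17)

This skeleton does NOT conclude the crux.  `XMapKernelOfCells` (`A → G → B → XMapKernel`) is summit-strength
(`XMapKernelIffSummit.xMapKernel_iff_summit`; STRATEGY-CENSUS r1–r3 in this directory: every typed split of it is
piece-equivalent modulo `HuberWustholzCurvePeriods`), so the forward generator G4 files the NEXT RUNG of the graded
family the crux's own floor lives in, as a line on the crux item:

* GRADED FAMILY `ModulusSectorKernel m` (gradation parameter: the Legendre modulus `m = k²` of ONE elliptic curve
  `y² = (1 − x²)(1 − m x²)`, all tensor degrees `(a, b, c)`): Conjecture 1 in kernel form on the sector of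
  `(K_m, E_m, π)`-monomial representations.  The summit gives every member (`modulusSectorKernel_of_summit`,
  F4 on-path), and `m = 1/2` is VERBATIM the proved floor `Grothendieck.LemniscaticSectorKernel`
  (stmt-8598, `SectorComplementRingJoin.lemniscaticSectorKernel_proof` @ a1c7a8d3d820) — F3 witness
  `modulusSectorKernel_half` below and `Lines/singular-modulus-two_special.lean`.
* THE RUNG `SingularModulusTwoSectorKernel := ModulusSectorKernel (3 − 2√2)`: the next singular modulus,
  `k₂ = √2 − 1`, `m₂ = k₂² = 3 − 2√2`, CM by `ℤ[√−2]` (discriminant −8, `j = 8000`), `K(1 − m₂) = √2 · K(m₂)`.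
  Numerics (AGM, double precision, this folder `NOTES.md ## Numerics`): `K₂ = 1.645568395293`,
  `E₂ = 1.501081045631`, `K′₂/K₂ − √2 = −2·10⁻¹⁶`, `E′₂ − (√2 E₂ − (2 − √2) K₂) = 8·10⁻¹⁵`,
  `4√2 E₂K₂ − 4K₂² − π = −6·10⁻¹⁴`; hence the `ℤ`-kernel of `ℤ[x,y,z] → ℝ`, `(x,y,z) ↦ (K₂,E₂,π)`, is the principal
  ideal of the NORM `M₂ = (4x² + z)² − 32x²y² = L₂ · L₂^σ`, `L₂ = 4√2·xy − 4x² − z` (given `trdeg = 2`).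

## Stubs (the proof of the rung, cut where the θ₀ = 1/2 proof stops)

At `m = 1/2` the floor was assembled (`Grothendieck.closes`-side items 0280 + 8611 + 8612) from ONE explicit
2-dimensional chain for Legendre's relation in the form `4EK − 2K² = π` (McKean–Moll ex. 2.3.9, Beta integrals at the
lemniscatic point), Chudnovsky's `AlgIndep{K(1/√2), E(1/√2)}` and a Fubini/ideal glue.  One rung up the special
Beta-chain is gone; what replaces it is STRUCTURAL and is exactly where new mathematics is needed:

1. `stub_cmPeriodTransferTwo` (first kind, size S–M): `[K(1−m₂)] ~ [√2·K(m₂)]` as 1-dimensional representations.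
   For discriminant −8 the CM isogeny composed with the `k ↔ k′` symmetry is the LANDEN 2-isogeny: `k₂ = √2 − 1` is the
   fixed point of Landen∘complement (`2√k₂/(1+k₂) = k′₂`, `1 + k₂ = √2`), so the stub is Gauss's ascending transformation
   `K(2√k/(1+k)) = (1+k)·K(k)` at `k = k₂`: ONE change of variables `y = √2·x/(1 + (√2−1)x²)`, 1-sheeted on the real
   cycle exactly as the closed tree item `RamanujanComposites.GaussLandenOneMove` (stmt-6750, `k = 1/4`); the general
   x-map engine of the proved cells 18265/10665 is not even needed (Lawden 1989 §3.9 (3.9.17)–(3.9.32)).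
2. `stub_cmQuasiPeriodTransferTwo` (second kind, size M, new in tree / classical in print):
   `[E(1−m₂)] ~ [√2·E(m₂) − (2−√2)·K(m₂)]` — Landen's transformation of the SECOND kind
   `E(2√k/(1+k)) = (2E(k) − k′²K(k))/(1+k)` at `k = k₂`: the same change of variables, integrand additivity, and ONE
   Newton–Leibniz move for the exact ALGEBRAIC differential carrying the boundary term of the incomplete identity.
   No tree theorem transfers a second-kind differential along an isogeny (`EllipticPeriodCells`' η-cells are defs;
   18265/10665/6750 are first kind).
3. `stub_singularLegendreTwo_of_transfers` (size M): the two transfers turn the PROVED all-moduli Legendre relation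
   `UnfoldedStokes.LegendreAllModuli` (stmt-3523, `legendreAllModuli_proof`) at `k = √2 − 1` — a 2-dimensional chain
   for `E K′ + E′K − K K′ = π/2` — into the SINGULAR Legendre relation `4√2·E₂K₂ − 4K₂² = π` inside the sector
   (product ideal `KZProductIdeal.of_mul_mem_relations`, reindexing `of_sub_of_reindex_mem_relations`, additivity).
4. `stub_trdegTwo` (size M, no CM input): `trdeg_ℚ ℚ(K₂, E₂, π) ≥ 2` from Chudnovsky 1984 Thm 7.2.6
   (`Chudnovsky1984_thm_7_2_6_holds`: `AlgIndep{ω₁, η₁}` for every algebraic Weierstrass curve) and the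
   Legendre ↔ Weierstrass period bookkeeping.
5. `stub_singularSectorGlueTwo` (size M–L, HARDEST — the structural difference from the floor): Fubini turns
   monomial representations into monomials in `(K₂,E₂,π)`; by 4 and the relation of 3 the kernel of
   `ℚ(√2)[x,y,z] → ℝ` is `(L₂)` (`L₂` linear in `z`), so the `ℤ`-kernel is `(M₂)` with `M₂ = L₂^σ·L₂` MONIC in `z`
   (integer division; the remainder dies by comparing `√2`-parts).  NORM TRICK: `X := [r_L] − [r_π] ∈ relations`
   (stub 3) times `Y := [r_{L^σ}] − [r_π]` lies in `relations` (product ideal), and `X·Y` expands by Fubini,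
   coordinate PERMUTATIONS (rule 2 — the `√2`-terms cancel only after a swap) and integrand additivity to the formal
   `M₂`-combination; the conjugate factor alone is unrealisable (`L₂^σ(K₂,E₂,π) ≈ −27.9`).  Template:
   `SectorComplementRingJoin.lemniscaticSectorGlue_proof` (stmt-8612), where the generator `4xy − 2x² − z` was
   itself a realised relation.

Composition `SingularModulusTwoSectorKernel_of` is modus ponens on 1–5 (trivial seam, declared; the content sits in
the stubs, each strictly below the rung: 1–2 are dimension-1 statements, 3 and 5 are implications, 4 is pure
transcendence with no `KZ.relations` content — BC3 probes in the registrar folder `bc/`).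

Disproof used: none on record for this crux (`ledger crux ls stmt-KontsevichZagierPeriods-18976`: NOTES.md,
STRATEGY-CENSUS.md, Seams.lean, ModHW.lean — no Disproof.lean); negatives index of the summit: KinematicPlaneConvex
(`K = ∅` vacuity) — unrelated; every stub here has non-empty hypotheses-free content (explicit integrands).
-/

noncomputable section

open Literature.NumberTheory.Transcendental

namespace Summit.KontsevichZagierPeriods.KontsevichZagierPeriods.Cruxes.XMapKernelOfCells.SingularModulusTwo

/-! ## The graded family and the rung -/

/-- The graded family (gradation parameter `m = k²`, the Legendre modulus): Conjecture 1 in kernel form on the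
sector ring `ℤ[K_m, E_m, π]` — every `ℤ`-combination of monomial representations of type `(a,b,c)` (box
`(0,1)^{a+b} × ℝ^c`, integrand `∏ k_m(x_j) · ∏ e_m(x_j) · ∏ 1/(1+x_j²)` with `k_m(t) = 1/√((1−t²)(1−m t²))`,
`e_m(t) = √(1−m t²)/√(1−t²)`) with vanishing value lies in `KZ.relations`.
`ModulusSectorKernel (1/2)` is `Grothendieck.LemniscaticSectorKernel` up to `1 − (1/2)·t² = 1 − t²/2`. -/
def ModulusSectorKernel (m : ℝ) : Prop :=
  ∀ (ι : Type) [Fintype ι] (z : ι → ℤ) (a b c : ι → ℕ)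
    (r : ∀ i, KZ.IntegralRep ((a i + b i) + c i)),
    (∀ i, (r i).domain = {x | ∀ j : Fin (a i + b i), x (Fin.castAdd (c i) j) ∈ Set.Ioo (0:ℝ) 1}) →
    (∀ i, Set.EqOn (r i).integrand (fun x =>
        (∏ j : Fin (a i), (1 / Real.sqrt ((1 - x (Fin.castAdd (c i) (Fin.castAdd (b i) j)) ^ 2) *
            (1 - m * x (Fin.castAdd (c i) (Fin.castAdd (b i) j)) ^ 2)))) *
        (∏ j : Fin (b i), (Real.sqrt (1 - m * x (Fin.castAdd (c i) (Fin.natAdd (a i) j)) ^ 2) /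
            Real.sqrt (1 - x (Fin.castAdd (c i) (Fin.natAdd (a i) j)) ^ 2))) *
        ∏ j : Fin (c i), (1 / (1 + x (Fin.natAdd (a i + b i) j) ^ 2))) (r i).domain) →
    KZ.eval (∑ i, z i • KZ.of (r i)) = 0 →
    (∑ i, z i • KZ.of (r i)) ∈ KZ.relations

/-- THE RUNG (G4): the sector kernel of Conjecture 1 at the singular modulus of degree two,
`m₂ = 3 − 2√2 = (√2 − 1)²` (`K(1 − m₂) = √2 · K(m₂)`; CM by `ℤ[√−2]`, `j = 8000`). -/
def SingularModulusTwoSectorKernel : Prop := ModulusSectorKernel (3 - 2 * Real.sqrt 2)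

/-! ## Named statements of the stubs -/

/-- First-kind CM transfer at `N = 2`: `K(1 − m₂) = √2 · K(m₂)` as an identity between two
one-dimensional KZ representations on `(0,1)` (accessible: real CM x-map of degree 2, twist `c² = −2`). -/
def CMPeriodTransferTwo : Prop :=
  ∀ (r r' : KZ.IntegralRep 1),
    r.domain = {x | x 0 ∈ Set.Ioo (0:ℝ) 1} →
    Set.EqOn r.integrand
      (fun x => 1 / Real.sqrt ((1 - x 0 ^ 2) * (1 - (2 * Real.sqrt 2 - 2) * x 0 ^ 2))) r.domain →
    r'.domain = {x | x 0 ∈ Set.Ioo (0:ℝ) 1} →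
    Set.EqOn r'.integrand
      (fun x => Real.sqrt 2 / Real.sqrt ((1 - x 0 ^ 2) * (1 - (3 - 2 * Real.sqrt 2) * x 0 ^ 2))) r'.domain →
    KZ.Equivalent r r'

/-- Second-kind CM transfer at `N = 2`: `E(1 − m₂) = √2 · E(m₂) − (2 − √2) · K(m₂)` as an identity between two
one-dimensional KZ representations on `(0,1)` (the quasi-period pulled back along the CM x-map). -/
def CMQuasiPeriodTransferTwo : Prop :=
  ∀ (r r' : KZ.IntegralRep 1),
    r.domain = {x | x 0 ∈ Set.Ioo (0:ℝ) 1} →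
    Set.EqOn r.integrand
      (fun x => Real.sqrt (1 - (2 * Real.sqrt 2 - 2) * x 0 ^ 2) / Real.sqrt (1 - x 0 ^ 2)) r.domain →
    r'.domain = {x | x 0 ∈ Set.Ioo (0:ℝ) 1} →
    Set.EqOn r'.integrand
      (fun x => Real.sqrt 2 * Real.sqrt (1 - (3 - 2 * Real.sqrt 2) * x 0 ^ 2) / Real.sqrt (1 - x 0 ^ 2) -
        (2 - Real.sqrt 2) / Real.sqrt ((1 - x 0 ^ 2) * (1 - (3 - 2 * Real.sqrt 2) * x 0 ^ 2))) r'.domain →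
    KZ.Equivalent r r'

/-- The SINGULAR Legendre relation at `N = 2` as accessible identity: the 2-dimensional representation
`[(0,1)², 4√2·e₂(x₀)k₂(x₁) − 4·k₂(x₀)k₂(x₁)]` (value `4√2·E₂K₂ − 4K₂² = π`) is KZ-equivalent to
`[ℝ, 1/(1+x₀²)]` (value `π`). -/
def LegendreSingularTwo : Prop :=
  ∀ (r : KZ.IntegralRep 2) (r' : KZ.IntegralRep 1),
    r.domain = {x | ∀ i, x i ∈ Set.Ioo (0:ℝ) 1} →
    Set.EqOn r.integrand (fun x =>
      4 * Real.sqrt 2 * (Real.sqrt (1 - (3 - 2 * Real.sqrt 2) * x 0 ^ 2) / Real.sqrt (1 - x 0 ^ 2)) /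
          Real.sqrt ((1 - x 1 ^ 2) * (1 - (3 - 2 * Real.sqrt 2) * x 1 ^ 2)) -
        4 / Real.sqrt ((1 - x 0 ^ 2) * (1 - (3 - 2 * Real.sqrt 2) * x 0 ^ 2)) /
          Real.sqrt ((1 - x 1 ^ 2) * (1 - (3 - 2 * Real.sqrt 2) * x 1 ^ 2))) r.domain →
    r'.domain = Set.univ →
    Set.EqOn r'.integrand (fun x => 1 / (1 + x 0 ^ 2)) r'.domain →
    KZ.Equivalent r r'

/-- Transcendence input at `N = 2` WITHOUT CM: `trdeg_ℚ ℚ(K₂, E₂, π) ≥ 2` (Chudnovsky 1984 Thm 7.2.6,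
`AlgIndep{ω₁, η₁}` for the algebraic curve `y² = (1 − x²)(1 − m₂x²)`, plus `2πi = ω₁η₂ − ω₂η₁`). -/
def TrdegTwo : Prop :=
  (2 : Cardinal) ≤ Algebra.trdeg ℚ ↥(IntermediateField.adjoin ℚ
    ({(∫ x in Set.Ioo (0:ℝ) 1, 1 / Real.sqrt ((1 - x ^ 2) * (1 - (3 - 2 * Real.sqrt 2) * x ^ 2))),
      (∫ x in Set.Ioo (0:ℝ) 1, Real.sqrt (1 - (3 - 2 * Real.sqrt 2) * x ^ 2) / Real.sqrt (1 - x ^ 2)),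
      Real.pi} : Set ℝ))

/-! ## Registered stubs (`sorry` occurs only here) -/

/-- Stub 1 (first-kind transfer = ascending Landen/Gauss at the fixed modulus `k₂ = √2 − 1`, S–M): one change of
variables `y = √2·x/(1 + (√2 − 1)·x²)` on `(0,1)` (injective, onto `(0,1)`), pointwise identity of differentials
`√2·dx/√((1−x²)(1−k₂²x²)) = dy/√((1−y²)(1−k′₂²y²))`; shape of `RamanujanComposites.GaussLandenOneMove` (stmt-6750). -/
theorem stub_cmPeriodTransferTwo : CMPeriodTransferTwo := by
  sorry

/-- Stub 2 (second-kind Landen at `k₂`, M; new in tree, classical in print): under the same change of variables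
the pullback of `e_{k′₂}(y) dy` is `√2·e_{k₂}(x) dx − (2−√2)·k_{k₂}(x) dx + dG` with `G` algebraic on `[0,1]`,
`G(0) = G(1) = 0`-type boundary bookkeeping: rules 2, 1b and ONE Newton–Leibniz move (rule 3). -/
theorem stub_cmQuasiPeriodTransferTwo : CMQuasiPeriodTransferTwo := by
  sorry

/-- Stub 3 (M): `LegendreAllModuli` (stmt-3523, PROVED: `UnfoldedStokes.legendreAllModuli_proof`) at
`k = √2 − 1` gives a chain for `E₂K′₂ + E′₂K₂ − K₂K′₂ = π/2`; multiply the 1-dimensional transfers of stubs 1–2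
by `[E₂]`, `[K₂]` (product ideal `KZProductIdeal.of_mul_mem_relations`, `of_sub_of_reindex_mem_relations`), add
(`KZ.Equivalent.integrand_add/sub`), rescale by 2 (`volume_indicator`) to reach `4√2·E₂K₂ − 4K₂² ~ π`. -/
theorem stub_singularLegendreTwo_of_transfers :
    CMPeriodTransferTwo → CMQuasiPeriodTransferTwo → LegendreSingularTwo := by
  sorry

/-- Stub 4 (M, no CM): `Chudnovsky1984_thm_7_2_6_holds` for the Weierstrass model of `y² = (1−x²)(1−m₂x²)`
(`g₂, g₃ ∈ ℚ(√2)`), `ω₁ = 2K₂/…`, `η₁` affine in `(K₂, E₂)` over `ℚ̄`, and `π ∈` the field by Legendre's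
relation in Weierstrass form; pattern `GrothendieckKEAlgIndependent` (stmt-8611). -/
theorem stub_trdegTwo : TrdegTwo := by
  sorry

/-- Stub 5 (sector glue, M): template `SectorComplementRingJoin.lemniscaticSectorGlue_proof` (stmt-8612):
Fubini (`KZProduct`) makes `(r i).value = K₂^a E₂^b π^c`; by `TrdegTwo` + the relation of `LegendreSingularTwo`
(soundness `KZ.relations_le_ker_eval_holds`) the `ℤ`-kernel of `ℤ[x,y,z] → ℝ` is `(M₂)`,
`M₂ = (4x² + z)² − 32x²y² = (−4√2xy − 4x² − z)·(4√2xy − 4x² − z)`; the second factor is realised in `P_KZ` by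
`LegendreSingularTwo`, so every multiple lies in `KZ.relations` (`KZProductIdeal.of_mul_mem_relations`). -/
theorem stub_singularSectorGlueTwo : TrdegTwo → LegendreSingularTwo → SingularModulusTwoSectorKernel := by
  sorry

/-! ## Composition (no `sorry` below this line) -/

/-- `<Rung>_of`: the rung BY NAME from the five registered stubs (first theorem concluding the rung decl —
the registrar's skeleton; hypothesis-free, stubs fed in by name; trivial seam, declared). -/
theorem SingularModulusTwoSectorKernel_of : SingularModulusTwoSectorKernel :=
  stub_singularSectorGlueTwo stub_trdegTwo
    (stub_singularLegendreTwo_of_transfers stub_cmPeriodTransferTwo stub_cmQuasiPeriodTransferTwo)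

/-- Registrar alias (`ledger skeleton check --crux-decl …SingularModulusTwoSectorKernel`). This line concludes the
RUNG, never the crux `XMapKernelOfCells`. -/
theorem SingularModulusTwoSectorKernel_proof : SingularModulusTwoSectorKernel :=
  SingularModulusTwoSectorKernel_of

/-- The same composition from the five stub STATEMENTS (sorry-free as a term; BC3 reading
`stub₁-sig → … → stub₅-sig → Rung`). -/
theorem singularModulusTwoSectorKernel_of_stubs
    (h₁ : CMPeriodTransferTwo) (h₂ : CMQuasiPeriodTransferTwo)
    (h₃ : CMPeriodTransferTwo → CMQuasiPeriodTransferTwo → LegendreSingularTwo)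
    (h₄ : TrdegTwo) (h₅ : TrdegTwo → LegendreSingularTwo → SingularModulusTwoSectorKernel) :
    SingularModulusTwoSectorKernel :=
  h₅ h₄ (h₃ h₁ h₂)

/-! ## F3 witness and F4 on-path (sorry-free) -/

/-- F3: the family at the floor parameter `m = 1/2` IS the proved floor `LemniscaticSectorKernel`. -/
theorem modulusSectorKernel_half : ModulusSectorKernel (1 / 2) := by
  intro ι _ z a b c r hd hi he
  have h : ∀ y : ℝ, 1 - (1 / 2 : ℝ) * y ^ 2 = 1 - y ^ 2 / 2 := fun y => by ring
  refine Summit.KontsevichZagierPeriods.Grothendieck.SectorComplementRingJoin.lemniscaticSectorKernel_proof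
    ι z a b c r hd (fun i => ?_) he
  simpa only [h] using hi i

/-- F4 on-path: the summit (kernel form, `XMapKernel.Negative.summit_iff_kzKernelConjecture`) gives every
member of the family, in particular the rung. -/
theorem modulusSectorKernel_of_summit (m : ℝ) :
    _root_.KontsevichZagierPeriods → ModulusSectorKernel m := by
  intro hs ι _ z a b c r _ _ he
  exact (Summit.KontsevichZagierPeriods.XMapKernel.Negative.summit_iff_kzKernelConjecture.1 hs) _ he

theorem rung_of_summit : _root_.KontsevichZagierPeriods → SingularModulusTwoSectorKernel :=
  modulusSectorKernel_of_summit _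

end Summit.KontsevichZagierPeriods.KontsevichZagierPeriods.Cruxes.XMapKernelOfCells.SingularModulusTwo
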